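import Summits.BirchSwinnertonDyer.BirchSwinnertonDyer.Theorems.AlignedTransportAtTwoMainConjectureOfRankZeroBSDAtTwoFineRoadRealKummerCoefficients
import HarnessLib

/-!
# (A)₂ on the `Δ_E > 0` half-cell, read UPSTAIRS on `F_∞ = ℚ_∞(E[2])`: finiteness of the KUMMER-LINE HOM-SET — the
# `G_∞`-equivariant continuous homomorphisms `f : Gal(ℚ̄/F_∞) → E[2]` killing every decomposition group at a finite place
# and mapping every complex conjugation `c` into the Kummer line `(c − 1)·E[2^∞] ∩ E[2] = {O, T_min(c)}`

Cell `bsd-f1-sign2`, WIDTH-5 attach seat `bsd-line-att-p5` (gen 10) on line `birth` of crux C2 stmt-BirchSwinnertonDyer-22298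
`MainConjectureOfRankZeroBSDAtTwo` (route `AlignedTransportAtTwo`); sequel of `…FineRoadRealKummerCoefficients` (att-p5 g10) and of
att-p5 g5's `…FineRoadRelaxedCoefficientsRatTwo` §3 (the RELAXED Hom-set) / `…FineRoadStrictPerfectDescent` (the WIDE Hom-set). A
`--supports 22298 --as helper` file. HONEST FRAMING: THEOREMS ONLY — no definition, no named fact, no `sorry`; C2-NEUTRAL; BSD is NOT
proved by any of this.

WHAT. `H = Gal(ℚ̄/ℚ_∞)` (cyclotomic `ℤ₂`-extension), `H′ = H ⊓ ker ρ̄_{E,2} = Gal(ℚ̄/F_∞)` acts trivially on `E[2]`, so a class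
`x ∈ H¹(H′, E[2])` IS a continuous homomorphism `f_x` (`evalH1`). att-p5 g10 (`RealKummerCoefficients`): for `Δ_E > 0`,
(A)₂(E) ⟺ the downstairs group `Q` = {`E[2]`-classes over `ℚ_∞` locally trivial at the finite places, on the Kummer line at the real
place-conjugates} is finite. Here `Q` is carried through att-p3 g4's perfect descent `res : H¹(H, E[2]) ⥲ H¹(H′, E[2])^H`:
* §1 `evalH1_resOfLe_oneCocycleClass_of_le` (evaluation after restriction), **`evalH1_resOfLe_conjH1_eq_smul_evalH1`** (the real
  evaluation of a conjugate class read upstairs: `ev_w(conj_σ y) = σ • f_{res y}(σ⁻¹ g σ)`), `exists_smul_sub_eq_conj_iff` (the Kummer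
  line of the conjugate conjugation `σ⁻¹ g σ` is `σ⁻¹` of the Kummer line of `g`).
* §2 **`image_resOfLe_comap_inf_relaxed_eq`**: `res(Q)` = {`x ∈ Sel₀^{rel ∞}(H′; E[2])` | `H`-invariant ∧ `f_x(c) ∈ (c − 1)·E[2^∞]`
  for every conjugate `c = σ⁻¹ g σ` of the chosen complex conjugation `g`}; **`finite_twoTorsion_iff_finite_kummerLineHom`**:
  (A)₂(E) ⟺ THAT set is finite; and fully explicitly (**`finite_twoTorsion_iff_finite_kummerLineHom_explicit`**): (A)₂(E) ⟺ the set
  of `x` with (i) `f_x(σ⁻¹ n σ) = 0` for `n ∈ H′ ∩ D_v`, all finite `v`, all `σ` (kills every decomposition group of `F_∞` at a finite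
  place), (ii) `f_x(σ⁻¹ g σ) ∈ (σ⁻¹ g σ − 1)·E[2^∞]` for all `σ` (every complex conjugation of `F_∞` — a totally real field — goes to
  ITS Kummer line `{O, T_min}`: att-p5 g9 `RealKummerLetter`), (iii) `h • f_x(h⁻¹ n h) = f_x(n)` for `h ∈ H` (`G_∞`-equivariance),
  is finite. This Hom-set sits between the WIDE one (`f(c) = 0`: (A)₂ ⟹ finite, att-p5 g5) and the RELAXED one (no condition at `c`:
  finite ⟺ (A)₂^{rel ∞}); it is the one EQUIVALENT to (A)₂ — the lead's `Hom_{G_∞}(X(F_∞), E[2])` with the correct ramification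
  condition at the real places, short only of the class-field-theoretic name of `X`.

References: R. Greenberg, LNM 1716 (1999) §3, §4 (Lemma 4.6, p. 106); J. Coates, R. Sujatha, Math. Ann. 331 (2005) §3; J.-P. Serre,
*Galois Cohomology* I §2.3–2.6; J. H. Silverman, *AEC* X.1; crux workfiles `PERFECT-DESCENT.md` §3 (ii)–(v), `RELAXED-COEFFICIENTS-att-p5.md` §8.
-/

set_option autoImplicit false
-- the Theorems namespace of this sub repeats the summit name by design (D-0017 nested layout)
set_option linter.dupNamespace false

noncomputable section

open scoped Classical

namespace Summit.BirchSwinnertonDyer.BirchSwinnertonDyer.Theorems.AlignedTransportAtTwoFineRoad.RealKummerHom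

open WeierstrassCurve NumberField IsDedekindDomain Field Literature.NumberTheory.EllipticCurves
  Literature.NumberTheory.EllipticCurves.GreenbergSelmer Literature.NumberTheory.GaloisRepresentations
  Literature.NumberTheory.EllipticCurves.FineSelmerCoefficientMap
  Summit.BirchSwinnertonDyer.BirchSwinnertonDyer.Theorems.AlignedTransportAtTwoFineRoad
  Summit.BirchSwinnertonDyer.BirchSwinnertonDyer.Theorems.AlignedTransportAtTwoFineRoad.RelaxedPerfectDescentHom

/-! ## §1 Evaluation after restriction; the real evaluation of a conjugate class read upstairs -/

section Eval

variable {K : Type} [Field K] (W : WeierstrassCurve K)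

/-- Evaluation after restriction, generic: for `H₁ ≤ H₂ ≤ Γ_K` with `H₁` acting trivially on `E[2]`, `g ∈ H₁` and a cocycle `ζ` on
`H₂`, `f_{res [ζ]}(g) = ζ(g)`. [cite: SerreGaloisCohomology1997, I §2.3–2.4] -/
theorem evalH1_resOfLe_oneCocycleClass_of_le {H₁ H₂ : Subgroup (absoluteGaloisGroup K)} (hle : H₁ ≤ H₂)
    (htriv : ∀ (g : ↥H₁) (m : ↥(W.geomTorsion 2)), g • m = m) (g : ↥H₁)
    (ζ : contOneCocycles (discreteTopRep ↥H₂ ↥(W.geomTorsion 2))) :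
    evalH1 htriv g (resOfLe (↥(W.geomTorsion 2)) hle (oneCocycleClass _ ζ)) = ζ.1 ⟨(g : absoluteGaloisGroup K), hle g.2⟩ := by
  have hres : resOfLe (↥(W.geomTorsion 2)) hle (oneCocycleClass _ ζ) =
      oneCocycleClass _ (contOneCocycles.pullback (subgroupInclusion hle)
        (resHomOfEquivariant (subgroupInclusion hle) (AddMonoidHom.id _) (fun _ _ ↦ rfl)) ζ) :=
    map_oneCocycleClass _ _ _ ζ
  rw [hres, evalH1_oneCocycleClass, contOneCocycles.pullback_apply]
  rfl

variable {p : ℕ} [Fact p.Prime] (κ : ZpExtension K p)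

/-- **The real evaluation of a conjugate class, read upstairs.** Let `H = ker κ`, `H′ = H ⊓ ker ρ̄_{E,2}`, `D ≤ Γ_K` with `H ⊓ D`
acting trivially on `E[2]`, and `g ∈ H ⊓ D` lying in `ker ρ̄_{E,2}` (for `K = ℚ`, `D = D_w`, `Δ_E > 0`: a complex conjugation). Then
for every `y ∈ H¹(H, E[2])` and `σ ∈ Γ_K`: `ev_g(res_{H ⊓ D}(conj_σ y)) = σ • f_{res_{H′} y}(σ⁻¹ g σ)` — the value at `g` of the
conjugate class is `σ` applied to the value of the homomorphism `f_{res y}` at the conjugate conjugation `σ⁻¹ g σ ∈ H′`.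
[cite: SerreGaloisCohomology1997, I §2.5] [cite: ClarkSharif2010, §3.5] -/
theorem evalH1_resOfLe_conjH1_eq_smul_evalH1 {D : Subgroup (absoluteGaloisGroup K)}
    (htriv : ∀ (g : ↥(κ.kerSubgroup ⊓ D)) (m : ↥(W.geomTorsion 2)), g • m = m) (g : ↥(κ.kerSubgroup ⊓ D))
    (hg : (g : absoluteGaloisGroup K) ∈ (W.galoisRepTorsion 2).ker) (σ : absoluteGaloisGroup K)
    (y : subgroupH1 κ.kerSubgroup ↥(W.geomTorsion 2)) :
    evalH1 htriv g (resOfLe (↥(W.geomTorsion 2)) (inf_le_left : κ.kerSubgroup ⊓ D ≤ κ.kerSubgroup)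
        (conjH1 κ.kerSubgroup (↥(W.geomTorsion 2)) σ y)) =
      σ • evalH1 (smul_eq_self_divisionFieldTower W κ)
        ⟨σ⁻¹ * g * σ, conj_mem_of_normal (κ.kerSubgroup ⊓ (W.galoisRepTorsion 2).ker) σ ⟨g, g.2.1, hg⟩⟩
        (resOfLe (↥(W.geomTorsion 2)) (inf_le_left : κ.kerSubgroup ⊓ (W.galoisRepTorsion 2).ker ≤ κ.kerSubgroup) y) := by
  obtain ⟨ζ, rfl⟩ := oneCocycleClass_surjective _ y
  rw [conjH1_oneCocycleClass, evalH1_resOfLe_oneCocycleClass_of_le W inf_le_left htriv g,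
    evalH1_resOfLe_oneCocycleClass_of_le W inf_le_left (smul_eq_self_divisionFieldTower W κ), conjCocycle_apply]
  rfl

omit [Fact p.Prime] in
/-- **The Kummer line of a conjugate conjugation**: `t ∈ (σ⁻¹ g σ − 1)·E[2^∞]` iff `σ • t ∈ (g − 1)·E[2^∞]` (`a ↦ σ • a`).
With att-p5 g9's Kummer letter (`(g − 1)·E[2^∞] ∩ E[2] = {O, T_w}`): the line of `σ⁻¹ g σ` is `{O, σ⁻¹ • T_w}` — `T_min` for the
embedding `ι ∘ σ`. [cite: SilvermanAEC2009, X.1 (Prop. 1.4)] [cite: GreenbergLNM1716, §4 p. 106] -/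
theorem exists_smul_sub_eq_conj_iff (g σ : absoluteGaloisGroup K) (t : ↥(W.geomTorsion 2)) :
    (∃ a : ↥(W.geomPrimaryTorsion 2), (σ⁻¹ * g * σ) • a - a =
        AddSubgroup.inclusion (geomTorsion_le_geomPrimaryTorsion W 2) t) ↔
      ∃ a : ↥(W.geomPrimaryTorsion 2), g • a - a =
        AddSubgroup.inclusion (geomTorsion_le_geomPrimaryTorsion W 2) (σ • t) := by
  have hincl : ∀ (τ : absoluteGaloisGroup K) (s : ↥(W.geomTorsion 2)),
      AddSubgroup.inclusion (geomTorsion_le_geomPrimaryTorsion W 2) (τ • s) =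
        τ • AddSubgroup.inclusion (geomTorsion_le_geomPrimaryTorsion W 2) s := fun _ _ ↦ rfl
  constructor
  · rintro ⟨a, ha⟩
    refine ⟨σ • a, ?_⟩
    rw [hincl, ← ha, smul_sub, smul_smul, smul_smul, ← mul_assoc, ← mul_assoc, mul_inv_cancel, one_mul]
  · rintro ⟨a, ha⟩
    refine ⟨σ⁻¹ • a, ?_⟩
    have h := congrArg (fun b : ↥(W.geomPrimaryTorsion 2) ↦ σ⁻¹ • b) ha
    simp only [smul_sub, smul_smul, inv_mul_cancel, one_smul, hincl] at h
    rw [smul_smul, mul_inv_cancel_right]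
    exact h

omit [Fact p.Prime] in
/-- With att-p5 g9's Kummer letter `T_w` of `g` (`(g − 1)·E[2^∞] ∩ E[2] = {O, T_w}`), the Kummer line of the conjugate conjugation
`σ⁻¹ g σ` is `{O, σ⁻¹ • T_w}` — the letter `T_min` for the real embedding `ι ∘ σ` (att-p5 g9 `RealKummerLetter.kummerLetter_eq_T_min`).
[cite: SilvermanAEC2009, X.1 (Prop. 1.4)] [cite: GreenbergLNM1716, §4 p. 106] -/
theorem exists_smul_sub_eq_conj_iff_of_kummerLetter {g : absoluteGaloisGroup K} {Tw : ↥(W.geomTorsion 2)}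
    (hline : ∀ t : ↥(W.geomTorsion 2),
      (∃ a : ↥(W.geomPrimaryTorsion 2), g • a - a = AddSubgroup.inclusion (geomTorsion_le_geomPrimaryTorsion W 2) t) ↔
        (t = 0 ∨ t = Tw))
    (σ : absoluteGaloisGroup K) (t : ↥(W.geomTorsion 2)) :
    (∃ a : ↥(W.geomPrimaryTorsion 2), (σ⁻¹ * g * σ) • a - a =
        AddSubgroup.inclusion (geomTorsion_le_geomPrimaryTorsion W 2) t) ↔ (t = 0 ∨ t = σ⁻¹ • Tw) := by
  rw [exists_smul_sub_eq_conj_iff, hline, smul_eq_zero_iff_eq, eq_inv_smul_iff]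

end Eval

/-! ## §2 `E/ℚ`, `Δ_E > 0`: (A)₂ ⟺ the Kummer-line Hom-set on `F_∞ = ℚ_∞(E[2])` is finite -/

section RatTwo

variable (W : WeierstrassCurve ℚ) [W.IsElliptic] (κ : ZpExtension ℚ 2)

/-- **`res(Q)` upstairs.** For `E/ℚ`, `Δ_E > 0`, `w` the real place, `g ∈ ker κ ⊓ D_w` non-trivial (it fixes `E[2]`, so
`g ∈ H′ = ker κ ⊓ ker ρ̄_{E,2}`): the image under `res : H¹(ker κ, E[2]) → H¹(H′, E[2])` of the downstairs group
`Q = ι_*⁻¹(Sel₀(ℚ_∞, E[2^∞])) ⊓ Sel₀^{rel ∞}(ℚ_∞, E[2])` (att-p5 g10) is EXACTLY the set of classes `x` upstairs that lie in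
`Sel₀^{rel ∞}(H′; E[2])`, are `Gal(ℚ̄/ℚ_∞)`-invariant, and whose homomorphism sends every conjugate `c = σ⁻¹ g σ` into the Kummer
line `(c − 1)·E[2^∞]` (att-p3 g4's perfect descent `RelaxedPerfectDescent.image_resOfLe_relaxedFine_twoCoeff_eq` + §1 + att-p5 g9's
criterion `RealKummerLine.torsionToPrimaryH1Sub_mem_infKer_iff_exists` through `RealKummerCoefficients.exists_kummerLetter_mem_comap_inf_relaxed_iff`).
[cite: SerreGaloisCohomology1997, I §2.6] [cite: GreenbergLNM1716, §3 and §4 p. 106] -/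
theorem image_resOfLe_comap_inf_relaxed_eq (hΔ : 0 < W.Δ) (w : InfinitePlace ℚ)
    (htriv : ∀ (g : ↥(κ.kerSubgroup ⊓ decompInf w)) (m : ↥(W.geomTorsion 2)), g • m = m)
    {g : ↥(κ.kerSubgroup ⊓ decompInf w)} (hg : g ≠ 1) (hgker : (g : absoluteGaloisGroup ℚ) ∈ (W.galoisRepTorsion 2).ker) :
    resOfLe (↥(W.geomTorsion 2)) (inf_le_left : κ.kerSubgroup ⊓ (W.galoisRepTorsion 2).ker ≤ κ.kerSubgroup) ''
        (↑((W.fineSelmerInfty κ).comap (W.torsionToPrimaryH1Sub 2 κ.kerSubgroup) ⊓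
            fineSelmerInftyRelaxedInf (↥(W.geomTorsion 2)) κ) : Set (subgroupH1 κ.kerSubgroup ↥(W.geomTorsion 2))) =
      {x | x ∈ strictSelmerGroupOverRelaxedInf (κ.kerSubgroup ⊓ (W.galoisRepTorsion 2).ker) (↥(W.geomTorsion 2)) 2
            (fineData (↥(W.geomTorsion 2)) 2) ∧
          (∀ h ∈ κ.kerSubgroup, conjH1 (κ.kerSubgroup ⊓ (W.galoisRepTorsion 2).ker) (↥(W.geomTorsion 2)) h x = x) ∧
          ∀ σ : absoluteGaloisGroup ℚ, ∃ a : ↥(W.geomPrimaryTorsion 2),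
            (σ⁻¹ * g * σ) • a - a = AddSubgroup.inclusion (geomTorsion_le_geomPrimaryTorsion W 2)
              (evalH1 (smul_eq_self_divisionFieldTower W κ)
                ⟨σ⁻¹ * g * σ, conj_mem_of_normal (κ.kerSubgroup ⊓ (W.galoisRepTorsion 2).ker) σ ⟨g, g.2.1, hgker⟩⟩ x)} := by
  -- the downstairs description of `Q` and the Kummer letter
  obtain ⟨Tw, hTw0, hline, hQ⟩ := RealKummerCoefficients.exists_kummerLetter_mem_comap_inf_relaxed_iff W κ hΔ w htriv hg
  -- the real condition downstairs ⟺ the Kummer-line condition upstairs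
  have hreal : ∀ y : subgroupH1 κ.kerSubgroup ↥(W.geomTorsion 2), ∀ σ : absoluteGaloisGroup ℚ,
      (evalH1 htriv g (resOfLe (↥(W.geomTorsion 2)) (inf_le_left : κ.kerSubgroup ⊓ decompInf w ≤ κ.kerSubgroup)
            (conjH1 κ.kerSubgroup (↥(W.geomTorsion 2)) σ y)) = 0 ∨
          evalH1 htriv g (resOfLe (↥(W.geomTorsion 2)) (inf_le_left : κ.kerSubgroup ⊓ decompInf w ≤ κ.kerSubgroup)
            (conjH1 κ.kerSubgroup (↥(W.geomTorsion 2)) σ y)) = Tw) ↔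
        ∃ a : ↥(W.geomPrimaryTorsion 2),
          (σ⁻¹ * g * σ) • a - a = AddSubgroup.inclusion (geomTorsion_le_geomPrimaryTorsion W 2)
            (evalH1 (smul_eq_self_divisionFieldTower W κ)
              ⟨σ⁻¹ * g * σ, conj_mem_of_normal (κ.kerSubgroup ⊓ (W.galoisRepTorsion 2).ker) σ ⟨g, g.2.1, hgker⟩⟩
              (resOfLe (↥(W.geomTorsion 2))
                (inf_le_left : κ.kerSubgroup ⊓ (W.galoisRepTorsion 2).ker ≤ κ.kerSubgroup) y)) := by
    intro y σ
    rw [exists_smul_sub_eq_conj_iff, ← evalH1_resOfLe_conjH1_eq_smul_evalH1 W κ htriv g hgker σ y]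
    exact (hline _).symm
  ext x
  constructor
  · rintro ⟨y, hy, rfl⟩
    have hy' := (hQ y).mp hy
    refine ⟨?_, fun h hh ↦ conjH1_resOfLe_of_mem (M := ↥(W.geomTorsion 2)) inf_le_left hh y, fun σ ↦ (hreal y σ).mp (hy'.2 σ)⟩
    have hyR : y ∈ fineSelmerInftyRelaxedInf (↥(W.geomTorsion 2)) κ := hy.2
    rw [fineSelmerInftyRelaxedInf_eq] at hyR
    exact (RelaxedPerfectDescent.mem_relaxedFine_twoCoeff_iff_resOfLe_mem W κ.kerSubgroup 2 y).1 hyR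
  · rintro ⟨hx, hinv, hkl⟩
    have hmem : x ∈ resOfLe (W.geomTorsion 2) (inf_le_left : κ.kerSubgroup ⊓ (W.galoisRepTorsion 2).ker ≤ κ.kerSubgroup) ''
        (strictSelmerGroupOverRelaxedInf κ.kerSubgroup (W.geomTorsion 2) 2 (fineData (W.geomTorsion 2) 2) :
          Set (subgroupH1 κ.kerSubgroup (W.geomTorsion 2))) := by
      rw [RelaxedPerfectDescent.image_resOfLe_relaxedFine_twoCoeff_eq W κ.kerSubgroup 2]
      exact ⟨hx, hinv⟩
    obtain ⟨y, hyR, rfl⟩ := hmem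
    refine ⟨y, (hQ y).mpr ⟨?_, fun σ ↦ (hreal y σ).mpr (hkl σ)⟩, rfl⟩
    have hyR' : y ∈ fineSelmerInftyRelaxedInf (↥(W.geomTorsion 2)) κ := by
      rw [fineSelmerInftyRelaxedInf_eq]; exact hyR
    exact (RelaxedCoefficients.mem_fineSelmerInftyRelaxedInf_iff_resOfLe κ y).mp hyR'

/-- **(A)₂(E) ⟺ THE KUMMER-LINE HOM-SET IS FINITE** (`E/ℚ`, `Δ_E > 0`, cyclotomic `ℤ₂`-extension; `g ∈ ker κ ⊓ D_w` non-trivial,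
fixing `E[2]`): `Sel₀(ℚ_∞, E[2^∞])[2]` is finite iff the set of classes `x ∈ H¹(Gal(ℚ̄/F_∞), E[2])`, `F_∞ = ℚ_∞(E[2])`, lying in
`Sel₀^{rel ∞}(F_∞; E[2])`, invariant under `Gal(ℚ̄/ℚ_∞)`, and with `f_x(c) ∈ (c − 1)·E[2^∞]` for every conjugate `c` of `g`, is
finite (att-p5 g10 `RealKummerCoefficients.finite_pTorsion_iff_finite_comap_inf_relaxed` + `image_resOfLe_comap_inf_relaxed_eq` +
injectivity of `res`, att-p3 g4 `PerfectDescent.resOfLe_kerSubgroup_inf_ker_galoisRepTorsion_two_injective`).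
[cite: CoatesSujatha2005, §3 (statement (A))] [cite: GreenbergLNM1716, §4 Lemma 4.6 and p. 106] [cite: SerreGaloisCohomology1997, I §2.6] -/
theorem finite_twoTorsion_iff_finite_kummerLineHom (hκ : κ.IsCyclotomic) (hΔ : 0 < W.Δ) (w : InfinitePlace ℚ)
    (htriv : ∀ (g : ↥(κ.kerSubgroup ⊓ decompInf w)) (m : ↥(W.geomTorsion 2)), g • m = m)
    {g : ↥(κ.kerSubgroup ⊓ decompInf w)} (hg : g ≠ 1) (hgker : (g : absoluteGaloisGroup ℚ) ∈ (W.galoisRepTorsion 2).ker) :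
    Set.Finite {s : W.fineSelmerInfty κ | 2 • s = 0} ↔
      Set.Finite {x : subgroupH1 (κ.kerSubgroup ⊓ (W.galoisRepTorsion 2).ker) ↥(W.geomTorsion 2) |
        x ∈ strictSelmerGroupOverRelaxedInf (κ.kerSubgroup ⊓ (W.galoisRepTorsion 2).ker) (↥(W.geomTorsion 2)) 2
            (fineData (↥(W.geomTorsion 2)) 2) ∧
          (∀ h ∈ κ.kerSubgroup, conjH1 (κ.kerSubgroup ⊓ (W.galoisRepTorsion 2).ker) (↥(W.geomTorsion 2)) h x = x) ∧
          ∀ σ : absoluteGaloisGroup ℚ, ∃ a : ↥(W.geomPrimaryTorsion 2),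
            (σ⁻¹ * g * σ) • a - a = AddSubgroup.inclusion (geomTorsion_le_geomPrimaryTorsion W 2)
              (evalH1 (smul_eq_self_divisionFieldTower W κ)
                ⟨σ⁻¹ * g * σ, conj_mem_of_normal (κ.kerSubgroup ⊓ (W.galoisRepTorsion 2).ker) σ ⟨g, g.2.1, hgker⟩⟩ x)} := by
  have hA := RealKummerCoefficients.finite_pTorsion_iff_finite_comap_inf_relaxed W κ hκ (p := 2)
  refine hA.trans ?_
  rw [← image_resOfLe_comap_inf_relaxed_eq W κ hΔ w htriv hg hgker]
  exact (Set.finite_image_iff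
    (PerfectDescent.resOfLe_kerSubgroup_inf_ker_galoisRepTorsion_two_injective W κ).injOn).symm

/-- **(A)₂(E) ⟺ the Kummer-line Hom-set is finite, FULLY EXPLICITLY** (`E/ℚ`, `Δ_E > 0`, cyclotomic; hypotheses as above): statement
(A)₂ holds iff the set of classes `x ∈ H¹(Gal(ℚ̄/F_∞), E[2])` — continuous homomorphisms `f_x : Gal(ℚ̄/F_∞) → E[2]` — with
(i) `f_x(σ⁻¹ n σ) = 0` for every finite place `v` of `ℚ`, every `σ ∈ Γ_ℚ`, every `n ∈ H′ ∩ D_v` (`f_x` kills every decomposition group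
of `F_∞` at a finite place), (ii) `f_x(σ⁻¹ g σ) ∈ (σ⁻¹ g σ − 1)·E[2^∞]` for every `σ` (every complex conjugation of the totally real
field `F_∞` goes into ITS Kummer line `{O, T_min}` — one bit, the `2`-torsion point with the least abscissa in the corresponding real
embedding), (iii) `h • f_x(h⁻¹ n h) = f_x(n)` for all `h ∈ Gal(ℚ̄/ℚ_∞)` (`G_∞ = Gal(F_∞/ℚ_∞)`-equivariance), is finite. Between the WIDE
Hom-set (`f(c) = 0`; (A)₂ ⟹ finite, att-p5 g5 `StrictPerfectDescent`) and the RELAXED one (no condition at `c`; finite ⟺ (A)₂^{rel ∞},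
`RelaxedCoefficientsRatTwo`), this is the one EQUIVALENT to (A)₂: the lead's `Hom_{G_∞}(X(F_∞), E[2])` (PERFECT-DESCENT §3 (ii)) with
the CORRECT condition at the real places, short only of the class-field-theoretic name of `X`.
[cite: CoatesSujatha2005, §3 (statement (A))] [cite: GreenbergLNM1716, §4 Lemma 4.6 and pp. 106–107] [cite: SerreGaloisCohomology1997, I §2.3 and §2.6] -/
theorem finite_twoTorsion_iff_finite_kummerLineHom_explicit (hκ : κ.IsCyclotomic) (hΔ : 0 < W.Δ) (w : InfinitePlace ℚ)
    (htriv : ∀ (g : ↥(κ.kerSubgroup ⊓ decompInf w)) (m : ↥(W.geomTorsion 2)), g • m = m)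
    {g : ↥(κ.kerSubgroup ⊓ decompInf w)} (hg : g ≠ 1) (hgker : (g : absoluteGaloisGroup ℚ) ∈ (W.galoisRepTorsion 2).ker) :
    Set.Finite {s : W.fineSelmerInfty κ | 2 • s = 0} ↔
      Set.Finite {x : subgroupH1 (κ.kerSubgroup ⊓ (W.galoisRepTorsion 2).ker) ↥(W.geomTorsion 2) |
        (∀ (v : HeightOneSpectrum (𝓞 ℚ)) (σ : absoluteGaloisGroup ℚ)
            (n : ↥(κ.kerSubgroup ⊓ (W.galoisRepTorsion 2).ker)), (n : absoluteGaloisGroup ℚ) ∈ decomp v →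
            evalH1 (smul_eq_self_divisionFieldTower W κ) ⟨σ⁻¹ * n * σ, conj_mem_of_normal _ σ n⟩ x = 0) ∧
          (∀ h ∈ κ.kerSubgroup, ∀ n : ↥(κ.kerSubgroup ⊓ (W.galoisRepTorsion 2).ker),
            h • evalH1 (smul_eq_self_divisionFieldTower W κ) ⟨h⁻¹ * n * h, conj_mem_of_normal _ h n⟩ x =
              evalH1 (smul_eq_self_divisionFieldTower W κ) n x) ∧
          ∀ σ : absoluteGaloisGroup ℚ, ∃ a : ↥(W.geomPrimaryTorsion 2),
            (σ⁻¹ * g * σ) • a - a = AddSubgroup.inclusion (geomTorsion_le_geomPrimaryTorsion W 2)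
              (evalH1 (smul_eq_self_divisionFieldTower W κ)
                ⟨σ⁻¹ * g * σ, conj_mem_of_normal (κ.kerSubgroup ⊓ (W.galoisRepTorsion 2).ker) σ ⟨g, g.2.1, hgker⟩⟩ x)} := by
  rw [finite_twoTorsion_iff_finite_kummerLineHom W κ hκ hΔ w htriv hg hgker]
  refine iff_of_eq (congrArg Set.Finite (Set.ext fun x ↦ ?_))
  simp only [Set.mem_setOf_eq, mem_relaxedFine_upstairs_iff_forall_evalH1 W κ 2 x, conjH1_eq_self_iff_forall_evalH1 W κ]

/-- **The hypotheses hold for the cyclotomic `κ` and `Δ_E > 0`**: there is a non-trivial `g ∈ ker κ ⊓ D_w`, `ker κ ⊓ D_w` fixes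
`E[2]`, and every element of `D_w` lies in `ker ρ̄_{E,2}` (att-p5 g9 `RealKummerSelmer.exists_ne_one_and_smul_eq_self`; att-p5 g7/g8:
`Δ > 0` ⟺ complex conjugation fixes `E[2]` pointwise, `RealKummerWitness.forall_smul_eq_of_Δ_pos`).
[cite: Washington1997, §13.1] [cite: SilvermanAEC2009, III.1] -/
theorem exists_ne_one_and_smul_eq_self_and_mem_ker (hκ : κ.IsCyclotomic) (hΔ : 0 < W.Δ) (w : InfinitePlace ℚ) :
    (∃ g : ↥(κ.kerSubgroup ⊓ decompInf w), g ≠ 1) ∧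
      (∀ (g : ↥(κ.kerSubgroup ⊓ decompInf w)) (m : ↥(W.geomTorsion 2)), g • m = m) ∧
      ∀ g : ↥(κ.kerSubgroup ⊓ decompInf w), (g : absoluteGaloisGroup ℚ) ∈ (W.galoisRepTorsion 2).ker := by
  obtain ⟨hex, htriv⟩ := RealKummerSelmer.exists_ne_one_and_smul_eq_self W κ hκ hΔ w
  refine ⟨hex, htriv, fun g ↦ ?_⟩
  exact PerfectDescent.mem_ker_galoisRepTorsion_two_of_forall_smul_eq W fun m ↦ htriv g m

end RatTwo

end Summit.BirchSwinnertonDyer.BirchSwinnertonDyer.Theorems.AlignedTransportAtTwoFineRoad.RealKummerHom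

end
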